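import Mathlib
import Summits.ValiantsHypothesis.ValiantsHypothesis.Theses.NewtonUnitEquations

/-!
# Line `keyed-order-sweep` — skeleton for crux `DissociatedFixedK` (stmt-ValiantsHypothesis-5907)

Route `NewtonUnitEquations`, crux decl
`Summit.ValiantsHypothesis.ValiantsHypothesis.Theses.NewtonUnitEquations.DissociatedFixedK`
(`∀ k, ∃ C, ∀ m t A f, (#A j ≤ t) → (supp f i j ⊆ A j) → (sum map injective on Π_j A j) →
#extremePoints (conv (ι '' supp (Σ_i Π_j f i j))) ≤ (m t + 2) ^ C`).

## The line (idea card `Ideas/keyed-order-sweep.md`, triage r1: pass ×3)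
Replace "a generic direction" by the KEYED ORDER `sweepKey σ μ e = (σ·(e_y − μ·e_x), e_x, e_y)` read
lexicographically in `ℝ ×ₗ ℕ ×ₗ ℕ` (`σ = ±1`, `μ ∈ ℝ`): an injective ADDITIVE map, hence a
translation-invariant strict total order on `ℕ²` for every `(σ, μ)` — no genericity anywhere.
1. DICTIONARY (proved here, `coeff_sum_prod_of_injective`, `support_sum_prod_subset`): on a dissociated
   frame the coefficient of `Σ_i Π_j f_ij` at `Σ_j a_j` is the rank-`≤ k` tensor value
   `tensor (coefTensor f) a = Σ_i Π_j coeff (a j) (f i j)`, and the support lies in the frame image.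
2. `Stmt.stub_exposure`: every extreme point of `conv (ι '' P)` (`P ⊂ ℕ²` finite) is the UNIQUE `sweepKey σ μ`
   maximum of `P` for some sign `σ = ±1` and slope `μ` (strict support line in slope form; the strict
   separator `exists_strict_sep` is proved here, what remains is the slope/vertical conversion).
3. `Stmt.stub_thickness` (load-bearing; the landed `Negative.mixed_cube_lemma` (CubeLemma.lean) is its algebra):
   if the word `b` is the keyed top among the survivors `{a ∈ Π A_j : tensor c a ≠ 0}` then `b` differs
   from the coordinatewise keyed top `aI` of its alive sub-frame `subFrame A c (alivePattern c b)` in at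
   most `k - 1` coordinates (additivity of the key puts every other point of the sub-cube spanned by `b`
   and `aI` STRICTLY above `b`, so the tensor vanishes there; `sweepKey_sum_lt_sum` is proved here).
4. `Stmt.stub_count` (pure counting, no polynomials): words within Hamming distance `k - 1` of a signed-sweep
   box top of one of the `2^k` sub-frame families number `≤ 2^(k+1) (m t + 1)^k` — the EXCHANGE chain
   count `sweep_boxTop_ncard_le` (`≤ m (t-1) + 1` box tops per sign and family, PROVED here) times the
   Hamming ball `Σ_{s<k} C(m,s) t^s ≤ (m t + 1)^(k-1)`.
COMPOSITION `DissociatedFixedK_of : Stmt.stub_exposure → Stmt.stub_thickness → Stmt.stub_count → DissociatedFixedK`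
(kernel-checked, no sorry): a vertex `p = ι e*`, `e* ∈ supp`, is the strict keyed max of the support
(2); `e* = Σ a*` with `tensor ≠ 0` (1); the box tops `aI` of the alive sub-frame exist (nonempty: it
contains `a*_j`); (3) puts `a*` in the candidate set of (4) with `C := subFrame A (coefTensor f)`;
so `#vertices ≤ #candidates ≤ 2^(k+1)(mt+1)^k ≤ (mt+2)^(2k+1)`, i.e. `C(k) = 2k + 1`.

## Shape (D-0027 §3.3)
* `Stmt.stub_…` — the three stub statements as precise `Prop`s, named like the stubs (the skeleton audit
  admits a hypothesis of the composition iff the short name of its head constant is a registered stub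
  name; the `@[stub]` tag itself is gate-reserved, so it is not applied here);
* `stub_…` — the same statements as sorried theorems (these are the REGISTERED stubs; `sorry` occurs
  nowhere else in this file);
* `DissociatedFixedK_of : Stmt.stub_exposure → Stmt.stub_thickness → Stmt.stub_count → DissociatedFixedK`
  — the composition, real proof;
* `DissociatedFixedK_proof : DissociatedFixedK := DissociatedFixedK_of stub_exposure stub_thickness stub_count`
  (so the two copies of each statement are compiler-checked to agree).

## Disproof used (`Cruxes/DissociatedFixedK/Disproof.lean`, cdisprove v2: verdict TRUE, C = O(k))
* §B `dissociatedFixedK_false_without_card` — honoured: `#A j ≤ t` is used (only) in `Stmt.stub_count`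
  (via `sweep_boxTop_ncard_le` and the Hamming ball); `dissociatedFixedK_false_without_supp` — honoured:
  `supp f i j ⊆ A j` is used in the dictionary (`support_sum_prod_subset`, composition); dissociation is
  used exactly once, in `coeff_sum_prod_of_injective` (composition: `tensor ≠ 0` at the vertex word and
  `tensor ≠ 0 ⇒ in the support` for `htop`).  `…WithoutDissoc` (open) is not claimed.
* §C `not_dissociatedFixedKUniformC` — respected: the bound is `2^(k+1)(mt+1)^k`, `C(k) = 2k+1 → ∞`.
* §A' sharpness — respected: `Stmt.stub_thickness` claims radius `k - 1`, not less.
* Landed Negative lemmas: `Theorems/DissociatedFixedK/Negative/CubeLemma.lean` (its `mixed_cube_lemma`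
  is the algebra of stub 2; the lead adds `import …Theorems.DissociatedFixedK.Negative.CubeLemma` — at
  publish time the farm had not yet built that module, so it is cited by name here); `Negative/LoadBearing.lean`
  (`dissociatedFixedK_false_without_card/_supp`) refutes hypothesis-DELETED variants only, and no stub here
  is such an instance: every stub keeps the hypothesis it needs (checked by name against both files).
-/

namespace Summit.ValiantsHypothesis.ValiantsHypothesis.Cruxes.DissociatedFixedK.KeyedOrderSweep

open scoped BigOperators Classical

noncomputable section

/-! ## Objects of the line -/

/-- The embedding `ℕ² → ℝ²` of exponents used VERBATIM by the crux (`fun e i => ((e i : ℕ) : ℝ)`; same as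
`Negative.LoadBearing.emb`). -/
def emb (e : Fin 2 →₀ ℕ) : Fin 2 → ℝ := fun i => ((e i : ℕ) : ℝ)

theorem emb_injective : Function.Injective emb := by
  intro e e' h
  ext i
  have := congrFun h i
  simpa [emb] using this

/-- The KEYED ORDER of the sweep: primary key `σ * (e 1 - μ * e 0)`, ties broken by the exponent itself
in lex order.  Injective and additive. -/
def sweepKey (σ μ : ℝ) (e : Fin 2 →₀ ℕ) : ℝ ×ₗ ℕ ×ₗ ℕ :=
  toLex (σ * ((e 1 : ℝ) - μ * (e 0 : ℝ)), toLex (e 0, e 1))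

/-- The `(σ, μ)`-TOPS of a finite set `S ⊆ ℕ²`: its keyed-order maxima (a singleton when `S ≠ ∅`,
since the key is injective; stated as a `Finset` so that no proposition is defined here). -/
def sweepTops (σ μ : ℝ) (S : Finset (Fin 2 →₀ ℕ)) : Finset (Fin 2 →₀ ℕ) :=
  S.filter fun a => ∀ e ∈ S, sweepKey σ μ e ≤ sweepKey σ μ a

theorem mem_sweepTops {σ μ : ℝ} {S : Finset (Fin 2 →₀ ℕ)} {a : Fin 2 →₀ ℕ} :
    a ∈ sweepTops σ μ S ↔ a ∈ S ∧ ∀ e ∈ S, sweepKey σ μ e ≤ sweepKey σ μ a :=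
  Finset.mem_filter

/-- Value of the coefficient tensor `c` at the word `a`: `Σ_i Π_j c i j (a j)`. -/
def tensor {k m : ℕ} (c : Fin k → Fin m → (Fin 2 →₀ ℕ) → ℂ) (a : Fin m → (Fin 2 →₀ ℕ)) : ℂ :=
  ∑ i, ∏ j, c i j (a j)

/-- The coefficient letters of an instance: `c i j e = coeff e (f i j)`. -/
def coefTensor {k m : ℕ} (f : Fin k → Fin m → MvPolynomial (Fin 2) ℂ) :
    Fin k → Fin m → (Fin 2 →₀ ℕ) → ℂ :=
  fun i j e => MvPolynomial.coeff e (f i j)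

/-- Alive pattern of a word `b`: the products all of whose letters are nonzero at `b`. -/
def alivePattern {k m : ℕ} (c : Fin k → Fin m → (Fin 2 →₀ ℕ) → ℂ) (b : Fin m → (Fin 2 →₀ ℕ)) :
    Finset (Fin k) :=
  Finset.univ.filter fun i => ∀ j, c i j (b j) ≠ 0

/-- Sub-frame of an alive pattern `I`: the letters of `A j` at which every product of `I` is nonzero. -/
def subFrame {k m : ℕ} (A : Fin m → Finset (Fin 2 →₀ ℕ)) (c : Fin k → Fin m → (Fin 2 →₀ ℕ) → ℂ)
    (I : Finset (Fin k)) (j : Fin m) : Finset (Fin 2 →₀ ℕ) :=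
  (A j).filter fun e => ∀ i ∈ I, c i j e ≠ 0

/-! ## The three stubs as precise `Prop`s -/

/-- STUB 1 — EXPOSURE IN SWEEP FORM.  An extreme point of the hull of a finite set `P ⊂ ℕ²` is the
unique keyed-order maximum of `P` for some sign `σ = ±1` and slope `μ`.  (Strict separator `w` from
`exists_strict_sep`; if `w 1 ≠ 0` take `σ = sign (w 1)`, `μ = - w 0 / w 1`; if `w 1 = 0` the vertex is
the strict `x`-extreme and `σ = 1`, `μ = ∓ M` with `M > max_P e 1` works — or perturb `w`.) -/
def Stmt.stub_exposure : Prop :=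
  ∀ (P : Finset (Fin 2 →₀ ℕ)) (p : Fin 2 →₀ ℕ), p ∈ P →
    emb p ∈ Set.extremePoints ℝ (convexHull ℝ (emb '' (P : Set (Fin 2 →₀ ℕ)))) →
    ∃ σ μ : ℝ, (σ = 1 ∨ σ = -1) ∧ ∀ e ∈ P, e ≠ p → sweepKey σ μ e < sweepKey σ μ p

/-- STUB 2 — THICKNESS FOR A KEYED ORDER (load-bearing).  If `b ∈ Π A_j` has `tensor c b ≠ 0` and is
keyed-maximal among such words, and `aI j` is a keyed top of the alive sub-frame
`subFrame A c (alivePattern c b) j` for every `j`, then `#{j : b j ≠ aI j} + 1 ≤ k`.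
Proof route: the sub-cube `Q = Π_{j ∈ J} {b j, aI j} × Π_{j ∉ J} {b j}` (`J` = the deviation set) lies in
the frame (`aI j ∈ A j`), every `ε ≠ b` in `Q` has `sweepKey (Σ ε) > sweepKey (Σ b)` by
`sweepKey_sum_lt_sum` (`b j ∈ subFrame …` so `key (b j) < key (aI j)` on `J`), hence `tensor c ε = 0`;
in cube coordinates this is `Negative.mixed_cube_lemma` (alive products: all entries nonzero; a live
dead product is dead inside `J`), giving `card J + 1 ≤ #s ≤ k`.  No dissociation, no `σ = ±1` needed. -/
def Stmt.stub_thickness : Prop :=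
  ∀ (k m : ℕ) (A : Fin m → Finset (Fin 2 →₀ ℕ)) (c : Fin k → Fin m → (Fin 2 →₀ ℕ) → ℂ) (σ μ : ℝ)
    (b : Fin m → (Fin 2 →₀ ℕ)), (∀ j, b j ∈ A j) → tensor c b ≠ 0 →
    (∀ a : Fin m → (Fin 2 →₀ ℕ), (∀ j, a j ∈ A j) → tensor c a ≠ 0 →
      sweepKey σ μ (∑ j, a j) ≤ sweepKey σ μ (∑ j, b j)) →
    ∀ aI : Fin m → (Fin 2 →₀ ℕ),
      (∀ j, aI j ∈ sweepTops σ μ (subFrame A c (alivePattern c b) j)) →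
      (Finset.univ.filter fun j => b j ≠ aI j).card + 1 ≤ k

/-- STUB 3 — CANDIDATE COUNT (pure counting).  For a frame `A` (`#A j ≤ t`) and any family of
sub-frames `C I j ⊆ A j` indexed by `I ⊆ Fin k`, the words of `Π A_j` lying within Hamming distance
`k - 1` of the coordinatewise `(σ, μ)`-top `b` of some `C I` (`σ = ±1`, `μ ∈ ℝ`) number at most
`2^(k+1) (m t + 1)^k`: two signs × `2^k` families × `≤ m (t-1) + 1` box tops along `μ`
(`sweep_boxTop_ncard_le`, proved below) × Hamming ball `Σ_{s<k} C(m,s) t^s ≤ (m t + 1)^(k-1)`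
(e.g. by induction on the radius: `|Ball(b, s+1)| ≤ (1 + Σ_j #A j) · max_b' |Ball(b', s)|`).
`k = 0`: the set is empty. -/
def Stmt.stub_count : Prop :=
  ∀ (k m t : ℕ) (A : Fin m → Finset (Fin 2 →₀ ℕ)), (∀ j, (A j).card ≤ t) →
    ∀ C : Finset (Fin k) → Fin m → Finset (Fin 2 →₀ ℕ), (∀ I j, C I j ⊆ A j) →
      {a : Fin m → (Fin 2 →₀ ℕ) | (∀ j, a j ∈ A j) ∧
          ∃ (σ μ : ℝ) (I : Finset (Fin k)) (b : Fin m → (Fin 2 →₀ ℕ)), (σ = 1 ∨ σ = -1) ∧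
            (∀ j, b j ∈ sweepTops σ μ (C I j)) ∧
            (Finset.univ.filter fun j => a j ≠ b j).card + 1 ≤ k}.ncard
        ≤ 2 ^ (k + 1) * (m * t + 1) ^ k

/-! ## Registered stubs (the ONLY sorries of this file) -/

/-- Registered stub 1 = `Stmt.stub_exposure`. -/
theorem stub_exposure : ∀ (P : Finset (Fin 2 →₀ ℕ)) (p : Fin 2 →₀ ℕ), p ∈ P →
    emb p ∈ Set.extremePoints ℝ (convexHull ℝ (emb '' (P : Set (Fin 2 →₀ ℕ)))) →
    ∃ σ μ : ℝ, (σ = 1 ∨ σ = -1) ∧ ∀ e ∈ P, e ≠ p → sweepKey σ μ e < sweepKey σ μ p := by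
  sorry

/-- Registered stub 2 = `Stmt.stub_thickness`. -/
theorem stub_thickness : ∀ (k m : ℕ) (A : Fin m → Finset (Fin 2 →₀ ℕ))
    (c : Fin k → Fin m → (Fin 2 →₀ ℕ) → ℂ) (σ μ : ℝ)
    (b : Fin m → (Fin 2 →₀ ℕ)), (∀ j, b j ∈ A j) → tensor c b ≠ 0 →
    (∀ a : Fin m → (Fin 2 →₀ ℕ), (∀ j, a j ∈ A j) → tensor c a ≠ 0 →
      sweepKey σ μ (∑ j, a j) ≤ sweepKey σ μ (∑ j, b j)) →
    ∀ aI : Fin m → (Fin 2 →₀ ℕ),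
      (∀ j, aI j ∈ sweepTops σ μ (subFrame A c (alivePattern c b) j)) →
      (Finset.univ.filter fun j => b j ≠ aI j).card + 1 ≤ k := by
  sorry

/-- Registered stub 3 = `Stmt.stub_count`. -/
theorem stub_count : ∀ (k m t : ℕ) (A : Fin m → Finset (Fin 2 →₀ ℕ)), (∀ j, (A j).card ≤ t) →
    ∀ C : Finset (Fin k) → Fin m → Finset (Fin 2 →₀ ℕ), (∀ I j, C I j ⊆ A j) →
      {a : Fin m → (Fin 2 →₀ ℕ) | (∀ j, a j ∈ A j) ∧
          ∃ (σ μ : ℝ) (I : Finset (Fin k)) (b : Fin m → (Fin 2 →₀ ℕ)), (σ = 1 ∨ σ = -1) ∧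
            (∀ j, b j ∈ sweepTops σ μ (C I j)) ∧
            (Finset.univ.filter fun j => a j ≠ b j).card + 1 ≤ k}.ncard
        ≤ 2 ^ (k + 1) * (m * t + 1) ^ k := by
  sorry

/-! ## Proved tools of the line (sorry-free) -/

/-! ### The keyed order: projections, injectivity, additivity -/

theorem primary_le_of_key_le {σ μ : ℝ} {e a : Fin 2 →₀ ℕ} (h : sweepKey σ μ e ≤ sweepKey σ μ a) :
    σ * ((e 1 : ℝ) - μ * (e 0 : ℝ)) ≤ σ * ((a 1 : ℝ) - μ * (a 0 : ℝ)) := by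
  rcases (Prod.Lex.le_iff.1 h) with h1 | ⟨h1, -⟩
  · exact le_of_lt h1
  · exact le_of_eq h1

theorem eq_of_key_le_le {σ μ : ℝ} {e a : Fin 2 →₀ ℕ} (h : sweepKey σ μ e ≤ sweepKey σ μ a)
    (h' : sweepKey σ μ a ≤ sweepKey σ μ e) : e = a := by
  have heq : sweepKey σ μ e = sweepKey σ μ a := le_antisymm h h'
  unfold sweepKey at heq
  have h2 := congrArg (fun z => (ofLex (ofLex z).2)) heq
  simp only [ofLex_toLex] at h2
  obtain ⟨h0, h1⟩ := Prod.ext_iff.1 h2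
  ext i
  fin_cases i
  · exact h0
  · exact h1

/-- The keyed order is injective (it records the exponent itself). -/
theorem sweepKey_injective (σ μ : ℝ) : Function.Injective (sweepKey σ μ) := by
  intro e a h
  exact eq_of_key_le_le (le_of_eq h) (le_of_eq h.symm)

/-- The keyed order is ADDITIVE. -/
theorem sweepKey_add (σ μ : ℝ) (e d : Fin 2 →₀ ℕ) :
    sweepKey σ μ (e + d) = sweepKey σ μ e + sweepKey σ μ d := by
  unfold sweepKey
  rw [← toLex_add, Prod.mk_add_mk, ← toLex_add, Prod.mk_add_mk]
  simp only [Finsupp.add_apply, Nat.cast_add]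
  congr 2
  ring

/-- The keyed order as an additive monoid hom. -/
def sweepKeyHom (σ μ : ℝ) : (Fin 2 →₀ ℕ) →+ ℝ ×ₗ ℕ ×ₗ ℕ where
  toFun := sweepKey σ μ
  map_zero' := by
    show sweepKey σ μ 0 = 0
    unfold sweepKey
    simp only [Finsupp.coe_zero, Pi.zero_apply, Nat.cast_zero, mul_zero, sub_zero]
    rfl
  map_add' := sweepKey_add σ μ

@[simp] theorem sweepKeyHom_apply (σ μ : ℝ) (e : Fin 2 →₀ ℕ) : sweepKeyHom σ μ e = sweepKey σ μ e :=
  rfl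

theorem sweepKey_sum {ι : Type*} (s : Finset ι) (σ μ : ℝ) (a : ι → (Fin 2 →₀ ℕ)) :
    sweepKey σ μ (∑ j ∈ s, a j) = ∑ j ∈ s, sweepKey σ μ (a j) := by
  rw [← sweepKeyHom_apply, map_sum]
  rfl

/-- TRANSLATION-INVARIANCE IN SUM FORM (the "every other point of the sub-cube is strictly above"
step of `Stmt.stub_thickness`): coordinatewise `≤` with one strict coordinate gives a strict sum. -/
theorem sweepKey_sum_lt_sum {ι : Type*} (s : Finset ι) {σ μ : ℝ} {a b : ι → (Fin 2 →₀ ℕ)}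
    (hle : ∀ j ∈ s, sweepKey σ μ (a j) ≤ sweepKey σ μ (b j))
    (hlt : ∃ j ∈ s, sweepKey σ μ (a j) < sweepKey σ μ (b j)) :
    sweepKey σ μ (∑ j ∈ s, a j) < sweepKey σ μ (∑ j ∈ s, b j) := by
  rw [sweepKey_sum, sweepKey_sum]
  exact Finset.sum_lt_sum hle hlt

theorem sweepKey_sum_le_sum {ι : Type*} (s : Finset ι) {σ μ : ℝ} {a b : ι → (Fin 2 →₀ ℕ)}
    (hle : ∀ j ∈ s, sweepKey σ μ (a j) ≤ sweepKey σ μ (b j)) :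
    sweepKey σ μ (∑ j ∈ s, a j) ≤ sweepKey σ μ (∑ j ∈ s, b j) := by
  rw [sweepKey_sum, sweepKey_sum]
  exact Finset.sum_le_sum hle

/-! ### Exchange monotonicity and the chain count (the counting engine of `Stmt.stub_count`) -/

/-- EXCHANGE: along `μ`, `σ * x(top)` is non-increasing, and equal abscissa forces equal tops. -/
theorem sweepTop_exchange' {σ : ℝ} (hσ : σ = 1 ∨ σ = -1) {S : Finset (Fin 2 →₀ ℕ)} {μ μ' : ℝ}
    (h : μ ≤ μ') {a a' : Fin 2 →₀ ℕ}
    (ha : a ∈ sweepTops σ μ S) (ha' : a' ∈ sweepTops σ μ' S) :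
    σ * ((a' 0 : ℕ) : ℝ) < σ * ((a 0 : ℕ) : ℝ) ∨ a' = a := by
  rw [mem_sweepTops] at ha ha'
  have hσ2 : σ * σ = 1 := by rcases hσ with rfl | rfl <;> norm_num
  have P1 := primary_le_of_key_le (ha.2 a' ha'.1)
  have P2 := primary_le_of_key_le (ha'.2 a ha.1)
  have prod : (μ' - μ) * (σ * (((a' 0 : ℕ) : ℝ) - ((a 0 : ℕ) : ℝ))) ≤ 0 := by nlinarith [P1, P2]
  rcases lt_trichotomy (σ * ((a' 0 : ℕ) : ℝ)) (σ * ((a 0 : ℕ) : ℝ)) with hlt | heq | hgt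
  · exact Or.inl hlt
  · right
    have e0r : ((a' 0 : ℕ) : ℝ) = ((a 0 : ℕ) : ℝ) := by
      calc ((a' 0 : ℕ) : ℝ) = σ * σ * ((a' 0 : ℕ) : ℝ) := by rw [hσ2, one_mul]
        _ = σ * (σ * ((a' 0 : ℕ) : ℝ)) := by ring
        _ = σ * (σ * ((a 0 : ℕ) : ℝ)) := by rw [heq]
        _ = ((a 0 : ℕ) : ℝ) := by rw [← mul_assoc, hσ2, one_mul]
    have e0 : a' 0 = a 0 := by exact_mod_cast e0r
    rw [e0r] at P1 P2
    have e1r : σ * ((a' 1 : ℕ) : ℝ) = σ * ((a 1 : ℕ) : ℝ) := by nlinarith [P1, P2]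
    have e1r' : ((a' 1 : ℕ) : ℝ) = ((a 1 : ℕ) : ℝ) := by
      calc ((a' 1 : ℕ) : ℝ) = σ * (σ * ((a' 1 : ℕ) : ℝ)) := by rw [← mul_assoc, hσ2, one_mul]
        _ = σ * (σ * ((a 1 : ℕ) : ℝ)) := by rw [e1r]
        _ = ((a 1 : ℕ) : ℝ) := by rw [← mul_assoc, hσ2, one_mul]
    have e1 : a' 1 = a 1 := by exact_mod_cast e1r'
    ext i
    fin_cases i
    · exact e0
    · exact e1
  · exfalso
    have hμ : μ' = μ := by
      by_contra hne
      have hlt : μ < μ' := lt_of_le_of_ne h (Ne.symm hne)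
      nlinarith
    subst hμ
    have := eq_of_key_le_le (ha.2 a' ha'.1) (ha'.2 a ha.1)
    rw [this] at hgt
    exact lt_irrefl _ hgt

/-- CHAIN COUNT: the coordinatewise tops of a box `Π_j S j` (`#S j ≤ t`) along one signed sweep take
at most `m (t-1) + 1` values (an injective rank function into `{0,…,m(t-1)}`). -/
theorem sweep_boxTop_ncard_le (m t : ℕ) (S : Fin m → Finset (Fin 2 →₀ ℕ))
    (hS : ∀ j, (S j).card ≤ t) (σ : ℝ) (hσ : σ = 1 ∨ σ = -1) :
    {a : Fin m → (Fin 2 →₀ ℕ) | ∃ μ : ℝ, ∀ j, a j ∈ sweepTops σ μ (S j)}.ncard ≤ m * (t - 1) + 1 := by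
  classical
  -- rank function
  let Φ : (Fin m → (Fin 2 →₀ ℕ)) → ℕ := fun a =>
    ∑ j, ((S j).filter fun e => σ * (((a j) 0 : ℕ) : ℝ) < σ * ((e 0 : ℕ) : ℝ)).card
  set X : Set (Fin m → (Fin 2 →₀ ℕ)) := {a | ∃ μ : ℝ, ∀ j, a j ∈ sweepTops σ μ (S j)} with hX
  -- Φ maps X into range (m (t-1) + 1)
  have hmaps : ∀ a ∈ X, Φ a ∈ (↑(Finset.range (m * (t - 1) + 1)) : Set ℕ) := by
    intro a ha
    obtain ⟨μ, hμ⟩ := ha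
    rw [Finset.coe_range, Set.mem_Iio, Nat.lt_succ_iff]
    have hle : ∀ j, ((S j).filter fun e => σ * (((a j) 0 : ℕ) : ℝ) < σ * ((e 0 : ℕ) : ℝ)).card
        ≤ t - 1 := by
      intro j
      have hsub : ((S j).filter fun e => σ * (((a j) 0 : ℕ) : ℝ) < σ * ((e 0 : ℕ) : ℝ))
          ⊆ (S j).erase (a j) := by
        intro e he
        rw [Finset.mem_filter] at he
        rw [Finset.mem_erase]
        refine ⟨?_, he.1⟩
        rintro rfl
        exact lt_irrefl _ he.2
      calc _ ≤ ((S j).erase (a j)).card := Finset.card_le_card hsub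
        _ = (S j).card - 1 := Finset.card_erase_of_mem (mem_sweepTops.1 (hμ j)).1
        _ ≤ t - 1 := Nat.sub_le_sub_right (hS j) 1
    calc Φ a ≤ ∑ _j : Fin m, (t - 1) := Finset.sum_le_sum fun j _ => hle j
      _ = m * (t - 1) := by simp
  -- Φ is injective on X
  have hinj : Set.InjOn Φ X := by
    have hlt : ∀ a ∈ X, ∀ a' ∈ X, ∀ μ μ' : ℝ, μ ≤ μ' → (∀ j, a j ∈ sweepTops σ μ (S j)) →
        (∀ j, a' j ∈ sweepTops σ μ' (S j)) → a ≠ a' → Φ a < Φ a' := by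
      intro a _ a' _ μ μ' hμμ' ha ha' hne
      have hex : ∀ j, σ * (((a' j) 0 : ℕ) : ℝ) < σ * (((a j) 0 : ℕ) : ℝ) ∨ a' j = a j :=
        fun j => sweepTop_exchange' hσ hμμ' (ha j) (ha' j)
      obtain ⟨j₀, hj₀⟩ : ∃ j₀, a j₀ ≠ a' j₀ := by
        by_contra hall
        push Not at hall
        exact hne (funext hall)
      have hmono : ∀ j, ((S j).filter fun e => σ * (((a j) 0 : ℕ) : ℝ) < σ * ((e 0 : ℕ) : ℝ)) ⊆
          ((S j).filter fun e => σ * (((a' j) 0 : ℕ) : ℝ) < σ * ((e 0 : ℕ) : ℝ)) := by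
        intro j e he
        rw [Finset.mem_filter] at he ⊢
        refine ⟨he.1, ?_⟩
        rcases hex j with h1 | h1
        · exact h1.trans he.2
        · rw [h1]; exact he.2
      apply Finset.sum_lt_sum (fun j _ => Finset.card_le_card (hmono j))
      refine ⟨j₀, Finset.mem_univ _, Finset.card_lt_card ?_⟩
      refine (Finset.ssubset_iff_of_subset (hmono j₀)).2 ⟨a j₀, ?_, ?_⟩
      · rw [Finset.mem_filter]
        refine ⟨(mem_sweepTops.1 (ha j₀)).1, ?_⟩
        rcases hex j₀ with h1 | h1
        · exact h1
        · exact absurd h1.symm hj₀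
      · rw [Finset.mem_filter]
        exact fun h => lt_irrefl _ h.2
    intro a haX a' haX' hΦ
    obtain ⟨μ, hμ⟩ := haX
    obtain ⟨μ', hμ'⟩ := haX'
    by_contra hne
    rcases le_total μ μ' with hle | hle
    · exact absurd hΦ (ne_of_lt (hlt a ⟨μ, hμ⟩ a' ⟨μ', hμ'⟩ μ μ' hle hμ hμ' hne))
    · exact absurd hΦ.symm (ne_of_lt (hlt a' ⟨μ', hμ'⟩ a ⟨μ, hμ⟩ μ' μ hle hμ' hμ (Ne.symm hne)))
  calc X.ncard ≤ (↑(Finset.range (m * (t - 1) + 1)) : Set ℕ).ncard :=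
        Set.ncard_le_ncard_of_injOn Φ hmaps hinj (Finset.finite_toSet _)
    _ = m * (t - 1) + 1 := by rw [Set.ncard_coe_finset, Finset.card_range]

/-! ### The dictionary (blueprint step 1): coefficient formula on a dissociated frame -/

/-- Expansion of a product over a frame into monomials indexed by frame words. -/
theorem prod_eq_sum_monomial {m : ℕ} (A : Fin m → Finset (Fin 2 →₀ ℕ))
    (g : Fin m → MvPolynomial (Fin 2) ℂ) (hg : ∀ j, (g j).support ⊆ A j) :
    ∏ j, g j = ∑ b ∈ Fintype.piFinset A,
      MvPolynomial.monomial (∑ j, b j) (∏ j, MvPolynomial.coeff (b j) (g j)) := by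
  classical
  have hexp : ∀ j, g j = ∑ e ∈ A j, MvPolynomial.monomial e (MvPolynomial.coeff e (g j)) := by
    intro j
    conv_lhs => rw [MvPolynomial.as_sum (g j)]
    apply Finset.sum_subset (hg j)
    intro e _ he
    rw [MvPolynomial.notMem_support_iff.1 he, map_zero]
  rw [show (∏ j, g j) = ∏ j, ∑ e ∈ A j, MvPolynomial.monomial e (MvPolynomial.coeff e (g j)) from
    Finset.prod_congr rfl (fun j _ => hexp j)]
  rw [Finset.prod_univ_sum]
  refine Finset.sum_congr rfl fun b _ => ?_
  rw [MvPolynomial.monomial_sum_prod]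

theorem coeff_prod_of_injective {m : ℕ} (A : Fin m → Finset (Fin 2 →₀ ℕ))
    (g : Fin m → MvPolynomial (Fin 2) ℂ) (hg : ∀ j, (g j).support ⊆ A j)
    (hinj : ∀ a b : Fin m → (Fin 2 →₀ ℕ), (∀ j, a j ∈ A j) → (∀ j, b j ∈ A j) →
      ∑ j, a j = ∑ j, b j → a = b)
    (a : Fin m → (Fin 2 →₀ ℕ)) (ha : ∀ j, a j ∈ A j) :
    MvPolynomial.coeff (∑ j, a j) (∏ j, g j) = ∏ j, MvPolynomial.coeff (a j) (g j) := by
  classical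
  rw [prod_eq_sum_monomial A g hg, MvPolynomial.coeff_sum]
  simp only [MvPolynomial.coeff_monomial]
  rw [Finset.sum_eq_single a]
  · simp
  · intro b hb hba
    rw [if_neg]
    intro heq
    apply hba
    exact hinj b a (fun j => (Fintype.mem_piFinset.1 hb) j) ha heq
  · intro hna
    exact absurd (Fintype.mem_piFinset.2 ha) hna

/-- COEFFICIENT FORMULA on a dissociated frame: the coefficient of `Σ_i Π_j f_ij` at the frame point
`Σ_j a_j` is the tensor value `tensor (coefTensor f) a = Σ_i Π_j coeff (a j) (f i j)`.
(Dissociation is used exactly here.) -/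
theorem coeff_sum_prod_of_injective {k m : ℕ} (A : Fin m → Finset (Fin 2 →₀ ℕ))
    (f : Fin k → Fin m → MvPolynomial (Fin 2) ℂ) (hf : ∀ i j, (f i j).support ⊆ A j)
    (hinj : ∀ a b : Fin m → (Fin 2 →₀ ℕ), (∀ j, a j ∈ A j) → (∀ j, b j ∈ A j) →
      ∑ j, a j = ∑ j, b j → a = b)
    (a : Fin m → (Fin 2 →₀ ℕ)) (ha : ∀ j, a j ∈ A j) :
    MvPolynomial.coeff (∑ j, a j) (∑ i, ∏ j, f i j) = tensor (coefTensor f) a := by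
  rw [MvPolynomial.coeff_sum]
  exact Finset.sum_congr rfl fun i _ => coeff_prod_of_injective A (f i) (hf i) hinj a ha

/-- SUPPORT CONTAINMENT: every monomial of `Σ_i Π_j f_ij` is a frame point (no injectivity needed;
this is where `supp f i j ⊆ A j` is used). -/
theorem support_sum_prod_subset {k m : ℕ} (A : Fin m → Finset (Fin 2 →₀ ℕ))
    (f : Fin k → Fin m → MvPolynomial (Fin 2) ℂ) (hf : ∀ i j, (f i j).support ⊆ A j) :
    (∑ i, ∏ j, f i j).support ⊆ (Fintype.piFinset A).image (fun a => ∑ j, a j) := by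
  classical
  intro e he
  obtain ⟨i, _, hi⟩ := Finset.mem_biUnion.1 (MvPolynomial.support_sum he)
  rw [prod_eq_sum_monomial A (f i) (hf i)] at hi
  obtain ⟨b, hb, hbe⟩ := Finset.mem_biUnion.1 (MvPolynomial.support_sum hi)
  have := MvPolynomial.support_monomial_subset hbe
  rw [Finset.mem_singleton] at this
  exact Finset.mem_image.2 ⟨b, hb, this.symm⟩

/-! ### Strict exposure of a hull vertex (the Hahn–Banach half of `Stmt.stub_exposure`) -/

/-- A continuous linear functional on `Fin 2 → ℝ` is a dot product. -/
theorem exists_vec_of_clm (f : (Fin 2 → ℝ) →L[ℝ] ℝ) : ∃ w : Fin 2 → ℝ, ∀ p, f p = w ⬝ᵥ p := by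
  refine ⟨fun i => f (fun j => if i = j then 1 else 0), fun p => ?_⟩
  have h := (f : (Fin 2 → ℝ) →ₗ[ℝ] ℝ).pi_apply_eq_sum_univ p
  simp only [ContinuousLinearMap.coe_coe] at h
  rw [h]
  simp only [dotProduct, smul_eq_mul]
  refine Finset.sum_congr rfl fun i _ => ?_
  ring

/-- STRICT EXPOSURE of a vertex of the hull of a finite planar set: some `w` has `w ⬝ p < w ⬝ v` for
every other point `p` of the set (`p ∉ conv (S \ {p})` + `geometric_hahn_banach_point_closed`). -/
theorem exists_strict_sep (S : Finset (Fin 2 → ℝ)) {v : Fin 2 → ℝ}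
    (hv : v ∈ Set.extremePoints ℝ (convexHull ℝ (S : Set (Fin 2 → ℝ)))) :
    ∃ w : Fin 2 → ℝ, ∀ p ∈ S, p ≠ v → w ⬝ᵥ p < w ⬝ᵥ v := by
  have hnot : v ∉ convexHull ℝ ((S : Set (Fin 2 → ℝ)) \ {v}) := by
    have h := ((convex_convexHull ℝ (S : Set (Fin 2 → ℝ))).mem_extremePoints_iff_mem_sdiff_convexHull_sdiff).1 hv
    intro hmem
    apply h.2
    exact convexHull_mono (Set.sdiff_subset_sdiff_left (subset_convexHull ℝ _)) hmem
  have hfin : ((S : Set (Fin 2 → ℝ)) \ {v}).Finite := S.finite_toSet.sdiff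
  have hclosed : IsClosed (convexHull ℝ ((S : Set (Fin 2 → ℝ)) \ {v})) := hfin.isClosed_convexHull ℝ
  obtain ⟨f, u, hfu, hub⟩ := geometric_hahn_banach_point_closed (convex_convexHull ℝ _) hclosed hnot
  obtain ⟨w, hw⟩ := exists_vec_of_clm f
  refine ⟨-w, fun p hp hpv => ?_⟩
  have hp' : u < f p := hub p (subset_convexHull ℝ _ ⟨hp, hpv⟩)
  rw [hw] at hfu hp'
  simp only [neg_dotProduct]
  linarith

/-! ## The composition (kernel-checked): the three stubs imply the crux BY NAME -/

/-- `2^(k+1) (mt+1)^k ≤ (mt+2)^(2k+1)`. -/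
theorem bound_arith (k m t : ℕ) : 2 ^ (k + 1) * (m * t + 1) ^ k ≤ (m * t + 2) ^ (2 * k + 1) := by
  have h2 : 2 ^ (k + 1) ≤ (m * t + 2) ^ (k + 1) := Nat.pow_le_pow_left (by omega) _
  have h3 : (m * t + 1) ^ k ≤ (m * t + 2) ^ k := Nat.pow_le_pow_left (by omega) _
  calc 2 ^ (k + 1) * (m * t + 1) ^ k ≤ (m * t + 2) ^ (k + 1) * (m * t + 2) ^ k :=
        Nat.mul_le_mul h2 h3
    _ = (m * t + 2) ^ (2 * k + 1) := by
        rw [← pow_add]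
        congr 1
        omega

/-- COMPOSITION.  `Stmt.stub_exposure → Stmt.stub_thickness → Stmt.stub_count → DissociatedFixedK` with `C(k) = 2k+1`:
every vertex is `ι (Σ_j a_j)` for a word `a` in the candidate set of `Stmt.stub_count` taken with the
sub-frame family `C := subFrame A (coefTensor f)` (dictionary + exposure + thickness), and the image of
a finite set has at most as many elements. -/
theorem DissociatedFixedK_of :
    Stmt.stub_exposure → Stmt.stub_thickness → Stmt.stub_count →
      Summit.ValiantsHypothesis.ValiantsHypothesis.Theses.NewtonUnitEquations.DissociatedFixedK := by
  intro hExp hThick hCount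
  unfold Stmt.stub_exposure at hExp
  unfold Stmt.stub_thickness at hThick
  unfold Stmt.stub_count at hCount
  intro k
  refine ⟨2 * k + 1, ?_⟩
  intro m t A f hA hf hinj
  -- the candidate set of `Stmt.stub_count` for the sub-frame family of this instance
  have hbound := hCount k m t A hA (subFrame A (coefTensor f)) (fun I j => Finset.filter_subset _ _)
  set Cand : Set (Fin m → (Fin 2 →₀ ℕ)) := {a : Fin m → (Fin 2 →₀ ℕ) | (∀ j, a j ∈ A j) ∧
      ∃ (σ μ : ℝ) (I : Finset (Fin k)) (b : Fin m → (Fin 2 →₀ ℕ)), (σ = 1 ∨ σ = -1) ∧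
        (∀ j, b j ∈ sweepTops σ μ (subFrame A (coefTensor f) I j)) ∧
        (Finset.univ.filter fun j => a j ≠ b j).card + 1 ≤ k} with hCand
  have hfin : Cand.Finite := by
    refine Set.Finite.subset (Finset.finite_toSet (Fintype.piFinset A)) ?_
    intro a ha
    rw [hCand] at ha
    exact Finset.mem_coe.2 (Fintype.mem_piFinset.2 ha.1)
  -- every extreme point is the image of a candidate word
  have hcover : Set.extremePoints ℝ (convexHull ℝ ((fun e : Fin 2 →₀ ℕ => fun i : Fin 2 =>
      ((e i : ℕ) : ℝ)) '' ((∑ i, ∏ j, f i j).support : Set (Fin 2 →₀ ℕ)))) ⊆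
      (fun a : Fin m → (Fin 2 →₀ ℕ) => emb (∑ j, a j)) '' Cand := by
    intro p hp
    have hpS : p ∈ (fun e : Fin 2 →₀ ℕ => fun i : Fin 2 => ((e i : ℕ) : ℝ)) ''
        ((∑ i, ∏ j, f i j).support : Set (Fin 2 →₀ ℕ)) := extremePoints_convexHull_subset hp
    obtain ⟨eStar, heS, rfl⟩ := hpS
    have heS' : eStar ∈ (∑ i, ∏ j, f i j).support := heS
    -- exposure: the vertex is the strict keyed max of the support for some (σ, μ)
    have hp' : emb eStar ∈ Set.extremePoints ℝ (convexHull ℝ (emb ''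
        ((∑ i, ∏ j, f i j).support : Set (Fin 2 →₀ ℕ)))) := hp
    obtain ⟨σ, μ, hσ, hlt⟩ := hExp (∑ i, ∏ j, f i j).support eStar heS' hp'
    -- dictionary: the vertex is the sum of a frame word with nonzero tensor value
    obtain ⟨aStar, haPi, haSum⟩ := Finset.mem_image.1 (support_sum_prod_subset A f hf heS')
    have haStar : ∀ j, aStar j ∈ A j := fun j => Fintype.mem_piFinset.1 haPi j
    have hT : tensor (coefTensor f) aStar ≠ 0 := by
      have h1 := MvPolynomial.mem_support_iff.1 heS'
      rw [← haSum, coeff_sum_prod_of_injective A f hf hinj aStar haStar] at h1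
      exact h1
    -- the vertex word is keyed-maximal among the survivors
    have htop : ∀ a : Fin m → (Fin 2 →₀ ℕ), (∀ j, a j ∈ A j) → tensor (coefTensor f) a ≠ 0 →
        sweepKey σ μ (∑ j, a j) ≤ sweepKey σ μ (∑ j, aStar j) := by
      intro a ha hTa
      have hmem : (∑ j, a j) ∈ (∑ i, ∏ j, f i j).support := by
        rw [MvPolynomial.mem_support_iff, coeff_sum_prod_of_injective A f hf hinj a ha]
        exact hTa
      by_cases heq : (∑ j, a j) = eStar
      · rw [heq, haSum]
      · rw [haSum]
        exact le_of_lt (hlt _ hmem heq)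
    -- box tops of the alive sub-frame exist (each sub-frame contains the vertex letter)
    have hexTop : ∀ j, ∃ x, x ∈ sweepTops σ μ
        (subFrame A (coefTensor f) (alivePattern (coefTensor f) aStar) j) := by
      intro j
      have hne : (subFrame A (coefTensor f) (alivePattern (coefTensor f) aStar) j).Nonempty := by
        refine ⟨aStar j, ?_⟩
        unfold subFrame
        rw [Finset.mem_filter]
        refine ⟨haStar j, fun i hi => ?_⟩
        unfold alivePattern at hi
        rw [Finset.mem_filter] at hi
        exact hi.2 j
      obtain ⟨x, hx, hmax⟩ := Finset.exists_max_image _ (sweepKey σ μ) hne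
      exact ⟨x, mem_sweepTops.2 (And.intro hx hmax)⟩
    choose aI haI using hexTop
    -- thickness
    have hthick := hThick k m A (coefTensor f) σ μ aStar haStar hT htop aI haI
    -- hence the vertex word is a candidate
    refine ⟨aStar, ?_, ?_⟩
    · rw [hCand]
      exact ⟨haStar, σ, μ, alivePattern (coefTensor f) aStar, aI, hσ, haI, hthick⟩
    · show emb (∑ j, aStar j) = emb eStar
      rw [haSum]
  -- count
  calc (Set.extremePoints ℝ (convexHull ℝ ((fun e : Fin 2 →₀ ℕ => fun i : Fin 2 =>
          ((e i : ℕ) : ℝ)) '' ((∑ i, ∏ j, f i j).support : Set (Fin 2 →₀ ℕ))))).ncard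
        ≤ ((fun a : Fin m → (Fin 2 →₀ ℕ) => emb (∑ j, a j)) '' Cand).ncard :=
          Set.ncard_le_ncard hcover (hfin.image _)
    _ ≤ Cand.ncard := Set.ncard_image_le hfin
    _ ≤ 2 ^ (k + 1) * (m * t + 1) ^ k := hbound
    _ ≤ (m * t + 2) ^ (2 * k + 1) := bound_arith k m t

/-- THE SKELETON: the crux, modulo exactly the three registered stubs. -/
theorem DissociatedFixedK_proof :
    Summit.ValiantsHypothesis.ValiantsHypothesis.Theses.NewtonUnitEquations.DissociatedFixedK :=
  DissociatedFixedK_of stub_exposure stub_thickness stub_count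

end

end Summit.ValiantsHypothesis.ValiantsHypothesis.Cruxes.DissociatedFixedK.KeyedOrderSweep
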